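import Literature.NumberTheory.LFunctions.HeckeLOneLowerBoundExplicit
import Literature.NumberTheory.LFunctions.RealZeroEffectiveRepulsionOdd
import Literature.NumberTheory.LFunctions.RealZeroEffectiveRepulsionExplicit
import Literature.NumberTheory.LFunctions.SiegelZeroClassNumberBound
import Literature.Barriers.Parity.SiegelZeroDichotomy
import Mathlib.Analysis.Real.Pi.Bounds
import HarnessLib

/-!
# The explicit LOWER half of (11.10), kernel-proved: `L(1, χ) ≥ 0.81 (1 − β)` at a real zero
# `β ≥ 1 − 1/(10 log q)`, and the explicit Hecke converse `L(1,χ) < 1/(8 log q) ⇒ 1 − β ≤ 3.2 L(1,χ)`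

Topic `Literature/NumberTheory/LFunctions`. Everything in this file is PROVED (theorems only; no
definition, no named fact; debt 0). Cell `parity-realchar` (SIEGEL INSTRUMENT), CONDITIONALS column:
I.1 kernel line (lower half), §1 dictionary («small `L(1,χ)` ⇒ Siegel zero of explicit quality»),
TARGET §2 comparator (Benli–Goel–Twiss–Zaman Lemma 2.9 prints `0.72 (1 − β₁) ≤ L(1,χ₁)` for
`q > 4·10⁵`, `β₁ > 1 − 1/(10 log q)`; the kernel gives `0.81` for every `q ≥ 10⁴`).

## The argument (hyperbola method AT the zero, six squares)

Let `χ` be a quadratic character mod `q ≥ 10⁴`, `χ ≠ χ₀`, and `β` a real zero of `L(s,χ)` with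
`κ = 1 − β ≤ 1/(4 log q)`. With `X = q⁶`, `D = q³`, `u = q^{3κ} ≤ e^{3/4}`, `W = X^κ = u²`, the
one-sided hyperbola estimate of `ZetaMulRpowSumUpperBound.lean` at `s = β` (where `Re L(β,χ) = 0`)
reads `G ≤ (W/κ) P + 2(u/q³)((q+1)A + q/κ)` with `G = ∑_{n ≤ X}(1∗χ)(n) n^{−β} ≥ 1 + 1/4 + … + 1/36 >
1.4913` (the squares: `(1∗χ)(m²) ≥ 1`), `P = ∑_{d ≤ D} χ(d)/d ≤ L(1,χ) + 2q/(D+1)`,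
`A = ∑_{e ≤ D} e^{−β} ≤ 1 + 3u log q`. Hence
`L(1,χ) ≥ 1.4913 κ/W − 4/q² − 2κ(q+1)(1 + 6.36 log q)/q³`, and with the a-priori bound
`κ ≥ 1000/q²` (for PRIMITIVE `χ` a consequence of the kernel repulsion `κ ≥ π/(√q log²q)` of
`RealZeroEffectiveRepulsionOdd.lean`, as `log q ≤ 4 q^{1/4}`) this is `≥ κ (1.4913/W − 0.0041)`.
Windows: `κ log q ≤ 1/10` gives `W ≤ e^{0.6}` and **`L(1,χ) ≥ 0.81 κ`**; `≤ 1/40` gives **`≥ 1.27 κ`**;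
`≤ 1/4` gives **`≥ 0.32 κ`**. Combined with the kernel Hecke lemma `lOne_ge_eighth_of_noRealZero_near_one`
(no zero on `[1 − 1/(4 log q), 1]` ⇒ `L(1,χ) ≥ 1/(8 log q)`): **if `L(1,χ) < 1/(8 log q)` then `L(s,χ)`
has a real zero `β ≥ 1 − 1/(4 log q)` with `1 − β ≤ L(1,χ)/0.32`** — a Siegel zero of
Tao–Teräväinen quality `≥ 0.32/(L(1,χ) log q)`.

## Contents (namespace `Literature.NumberTheory.LFunctions.RealZeroRepulsion`)

* `lOne_ge_of_realZero_master` — `χ ≠ χ₀` quadratic mod `q ≥ 10⁴`, `L(β,χ) = 0`, `1 − 1/(4 log q) ≤ β`,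
  `1000/q² ≤ 1 − β` ⇒ `(1−β)(1.4913 e^{−6(1−β) log q} − 0.0041) ≤ Re L(1,χ)`;
* `thousand_div_sq_le_one_sub_realZero` — the a-priori bound for primitive quadratic `χ` (`q ≥ 10⁴`);
* `lOne_ge_of_realZero_tenth` / `_fortieth` / `_quarter` — `0.81`, `1.27`, `0.32` in the three windows
  (primitive quadratic `χ` mod `q ≥ 10⁴`);
* `norm_LFunction_one_two_sided_of_realZero` — `0.81(1−β) ≤ L(1,χ) ≤ 55(1−β) log²q` (with the
  kernel upper half of `RealZeroEffectiveRepulsionExplicit.lean`): the explicit (11.10);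
* `norm_LFunction_one_ge_of_isSiegelZero` — a Tao–Teräväinen Siegel zero of quality `η` at
  `q ≥ 10⁴` has `L(1,χ) ≥ 0.81/(η log q)` (the illusory world cannot make `L(1,χ)` smaller than the
  zero allows);
* `exists_realZero_of_lOne_lt` — `L(1,χ) < 1/(8 log q)` ⇒ a real zero `β ∈ [1 − 1/(4 log q), 1)` with
  `0.32 (1−β) ≤ L(1,χ)`; `exists_isSiegelZero_of_lOne_mul_log_le` — `L(1,χ) log q ≤ ε ≤ 0.032` ⇒
  `IsSiegelZero χ η` for some `η ≥ 0.32/ε` (explicit form of «small `η_χ` ⇒ Siegel zero»);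
* (namespace `Literature.NumberTheory.LFunctions`) `classNumber_ge_of_realZero_explicit` /
  `_v3` / `classNumber_two_sided_of_realZero_explicit` — I.1 kernel line, LOWER half: for an
  imaginary quadratic `K` with odd `d_K`, `q = |d_K| ≥ 10⁴`, and a real zero `β ≥ 1 − 1/(10 log q)` of
  `L(s,χ_{d_K})`: `h_K ≥ (0.81/(2π)) w_K √q (1−β) = (0.81/π) √q (1−β)` (print via BGTZ Lemma 2.9:
  `0.36/π · w_K`, `q > 4·10⁵`); with the v3 upper half: `(0.81/π)√q(1−β) ≤ h_K ≤ (1/π)√q log²q (1−β)`;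
  `classNumber_bounds_of_isSiegelZero` (appended) — on the column's predicate: a Siegel zero of
  quality `η` of `χ_{d_K}` pins `0.81 √q/(π η log q) ≤ h_K ≤ 55 √q log q/(π η)`.

LABEL: instrument (kernel). WHAT THIS IS NOT: no statement about the existence of any real zero;
constants are not optimised (print: Hoffstein/BGTZ-type arguments give `0.72`–`1` in narrower ranges).

## References

* H. L. Montgomery, R. C. Vaughan, *Multiplicative Number Theory I*, CUP 2007, §11.2 (11.10),
  Thm. 11.14 (Case A), §2.1. [MontgomeryVaughan2007]
* K. Benli, S. Goel, H. Twiss, A. Zaman, Proc. AMS 154 (2026), Lemma 2.9 (print comparator `0.72`).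
  [BenliGoelTwissZaman2025]
* T. Tao, J. Teräväinen, J. London Math. Soc. 106 (2022), Definition 1.4, §3.3. [TaoTeravainen2021]
* J. Neukirch, *Algebraic Number Theory*, Ch. VII §5 (5.11) (class number formula). [NeukirchANT1999]
-/

noncomputable section

open Complex Filter Topology Finset
open Literature.NumberTheory.LFunctions.DirichletAbel
open Literature.NumberTheory.LFunctions.SiegelZero
open Literature.NumberTheory.LFunctions.Hecke
open Literature.Barriers.Parity

namespace Literature.NumberTheory.LFunctions.RealZeroRepulsion

variable {q : ℕ} [NeZero q] (χ : DirichletCharacter ℂ q)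

/-! ### Numerical lemmas -/

/-- `log q ≥ 9` for `q ≥ 10⁴`. [folklore] -/
private theorem nine_le_log' {q : ℕ} (hq : 10 ^ 4 ≤ q) : (9 : ℝ) ≤ Real.log q := by
  have hq' : (10 : ℝ) ^ 4 ≤ q := by exact_mod_cast hq
  rw [Real.le_log_iff_exp_le (by linarith)]
  have h1 : Real.exp 9 = Real.exp 1 ^ 9 := by rw [← Real.exp_nat_mul]; norm_num
  have h9 : Real.exp 1 ^ 9 ≤ 2.7182818286 ^ 9 :=
    pow_le_pow_left₀ (Real.exp_pos 1).le Real.exp_one_lt_d9.le 9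
  rw [h1]
  calc Real.exp 1 ^ 9 ≤ 2.7182818286 ^ 9 := h9
    _ ≤ (10 : ℝ) ^ 4 := by norm_num
    _ ≤ q := hq'

/-- `log q ≤ q/1000` for `q ≥ 10⁴`. [folklore] -/
private theorem log_le_div_thousand' {q : ℕ} (hq : 10 ^ 4 ≤ q) : Real.log q ≤ (q : ℝ) / 1000 := by
  have hq' : (10 : ℝ) ^ 4 ≤ q := by exact_mod_cast hq
  have hq0 : (0 : ℝ) < q := by linarith
  have he1 : Real.exp 1 ≤ (10 : ℝ) ^ 4 := le_trans Real.exp_one_lt_d9.le (by norm_num)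
  have hanti := Real.log_div_self_antitoneOn (a := (10 : ℝ) ^ 4) (b := (q : ℝ))
    (by simpa using he1) (by simpa using he1.trans hq') hq'
  have hlog4 : Real.log ((10 : ℝ) ^ 4) ≤ 10 := by
    rw [Real.log_le_iff_le_exp (by norm_num)]
    have h1 : Real.exp 10 = Real.exp 1 ^ 10 := by rw [← Real.exp_nat_mul]; norm_num
    have h10 : (2.7182818283 : ℝ) ^ 10 ≤ Real.exp 1 ^ 10 :=
      pow_le_pow_left₀ (by norm_num) Real.exp_one_gt_d9.le 10
    rw [h1]
    exact le_trans (by norm_num) h10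
  have h2 : Real.log q / q ≤ Real.log ((10 : ℝ) ^ 4) / 10 ^ 4 := hanti
  have h3 : Real.log ((10 : ℝ) ^ 4) / 10 ^ 4 ≤ 1 / 1000 := by
    rw [div_le_div_iff₀ (by norm_num) (by norm_num)]; linarith
  have h4 : Real.log q / q ≤ 1 / 1000 := h2.trans h3
  rwa [div_le_iff₀ hq0, one_div_mul_eq_div] at h4

/-- `e^{3/4} < 2.118` (`(e^{3/4})⁴ = e³ < 2.7182818286³ < 2.118⁴`). [folklore] -/
private theorem exp_three_quarters_lt : Real.exp (3 / 4) < 2.118 := by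
  have h4 : Real.exp (3 / 4) ^ 4 = Real.exp 1 ^ 3 := by
    rw [← Real.exp_nat_mul, ← Real.exp_nat_mul]; norm_num
  have he := Real.exp_one_lt_d9
  have he0 := Real.exp_pos (1 : ℝ)
  by_contra hcon
  push Not at hcon
  have h1 : (2.118 : ℝ) ^ 4 ≤ Real.exp (3 / 4) ^ 4 := pow_le_pow_left₀ (by norm_num) hcon 4
  have h2 : Real.exp 1 ^ 3 < 2.7182818286 ^ 3 := pow_lt_pow_left₀ he he0.le (by norm_num)
  rw [h4] at h1
  linarith [show (2.7182818286 : ℝ) ^ 3 < 2.118 ^ 4 by norm_num]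

/-- `e^{3/5} < 1.823` (`(e^{3/5})⁵ = e³`). [folklore] -/
private theorem exp_three_fifths_lt : Real.exp (3 / 5) < 1.823 := by
  have h5 : Real.exp (3 / 5) ^ 5 = Real.exp 1 ^ 3 := by
    rw [← Real.exp_nat_mul, ← Real.exp_nat_mul]; norm_num
  have he := Real.exp_one_lt_d9
  have he0 := Real.exp_pos (1 : ℝ)
  by_contra hcon
  push Not at hcon
  have h1 : (1.823 : ℝ) ^ 5 ≤ Real.exp (3 / 5) ^ 5 := pow_le_pow_left₀ (by norm_num) hcon 5
  have h2 : Real.exp 1 ^ 3 < 2.7182818286 ^ 3 := pow_lt_pow_left₀ he he0.le (by norm_num)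
  rw [h5] at h1
  linarith [show (2.7182818286 : ℝ) ^ 3 < 1.823 ^ 5 by norm_num]

/-- `e^{3/20} < 1.1625` (`(e^{3/20})²⁰ = e³`). [folklore] -/
private theorem exp_three_twentieths_lt : Real.exp (3 / 20) < 1.1625 := by
  have h20 : Real.exp (3 / 20) ^ 20 = Real.exp 1 ^ 3 := by
    rw [← Real.exp_nat_mul, ← Real.exp_nat_mul]; norm_num
  have he := Real.exp_one_lt_d9
  have he0 := Real.exp_pos (1 : ℝ)
  by_contra hcon
  push Not at hcon
  have h1 : (1.1625 : ℝ) ^ 20 ≤ Real.exp (3 / 20) ^ 20 := pow_le_pow_left₀ (by norm_num) hcon 20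
  have h2 : Real.exp 1 ^ 3 < 2.7182818286 ^ 3 := pow_lt_pow_left₀ he he0.le (by norm_num)
  rw [h20] at h1
  linarith [show (2.7182818286 : ℝ) ^ 3 < 1.1625 ^ 20 by norm_num]

/-- `e^{3/2} < 4.49` (`(e^{3/2})² = e³`). [folklore] -/
private theorem exp_three_halves_lt : Real.exp (3 / 2) < 4.49 := by
  have h2' : Real.exp (3 / 2) ^ 2 = Real.exp 1 ^ 3 := by
    rw [← Real.exp_nat_mul, ← Real.exp_nat_mul]; norm_num
  have he := Real.exp_one_lt_d9
  have he0 := Real.exp_pos (1 : ℝ)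
  by_contra hcon
  push Not at hcon
  have h1 : (4.49 : ℝ) ^ 2 ≤ Real.exp (3 / 2) ^ 2 := pow_le_pow_left₀ (by norm_num) hcon 2
  have h2 : Real.exp 1 ^ 3 < 2.7182818286 ^ 3 := pow_lt_pow_left₀ he he0.le (by norm_num)
  rw [h2'] at h1
  linarith [show (2.7182818286 : ℝ) ^ 3 < 4.49 ^ 2 by norm_num]

/-! ### The squares `(1∗χ)(m²) ≥ 1` (adapted from `HeckeLOneLowerBoundExplicit.lean`, rc-cond g7) -/

/-- `∑_{i < 2n+1} (−1)^i = 1`. [folklore] -/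
private theorem sum_range_neg_one_pow_odd' (n : ℕ) : ∑ i ∈ range (2 * n + 1), (-1 : ℝ) ^ i = 1 := by
  induction n with
  | zero => simp
  | succ n ih =>
    rw [show 2 * (n + 1) + 1 = 2 * n + 1 + 1 + 1 by ring, Finset.sum_range_succ,
      Finset.sum_range_succ, ih, Odd.neg_one_pow ⟨n, by ring⟩, Even.neg_one_pow ⟨n + 1, by ring⟩]
    norm_num

omit [NeZero q] in
/-- `(1∗χ)(m²) ≥ 1` for a quadratic `χ` and `m ≥ 1`. [folklore] -/
private theorem one_le_zetaMul_sq_re' (hq2 : χ ^ 2 = 1) {m : ℕ} (hm : 1 ≤ m) :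
    1 ≤ (χ.zetaMul (m ^ 2)).re := by
  induction m using Nat.recOnPrimeCoprime with
  | zero => omega
  | prime_pow p k hp =>
    rw [← pow_mul, SmoothEulerProduct.zetaMul_prime_pow_re χ hq2 hp]
    rcases SmoothEulerProduct.apply_re_trichotomy χ hq2 p with h | h | h <;> rw [h]
    · rw [Finset.sum_range_succ']
      simp
    · simp
    · rw [show k * 2 + 1 = 2 * k + 1 by ring, sum_range_neg_one_pow_odd']
  | coprime a b ha hb hab iha ihb =>
    rw [mul_pow, SmoothEulerProduct.zetaMul_re_mul χ hq2 (hab.pow 2 2)]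
    have h1 := iha (by omega)
    have h2 := ihb (by omega)
    nlinarith

omit [NeZero q] in
/-- `∑_{n ≤ X} (1∗χ)(n) n^{−β} ≥ 1 + 1/4 + 1/9 + 1/16 + 1/25 + 1/36 > 1.4913` for `β ≤ 1`, `X ≥ 36`.
[folklore] -/
private theorem sum_zetaMul_rpow_ge_squares' (hq2 : χ ^ 2 = 1) {β : ℝ} (hβ1 : β ≤ 1) {X : ℕ}
    (hX : 36 ≤ X) : 1.4913 ≤ ∑ n ∈ Icc 1 X, (χ.zetaMul n).re * (n : ℝ) ^ (-β) := by
  set f : ℕ → ℝ := fun n => (χ.zetaMul n).re * (n : ℝ) ^ (-β) with hf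
  have hnonneg : ∀ n ∈ Icc 1 X, 0 ≤ f n := fun n _ =>
    mul_nonneg (SmoothEulerProduct.zetaMul_re_nonneg χ hq2 n) (Real.rpow_nonneg (Nat.cast_nonneg n) _)
  have hsq : ∀ m : ℕ, 1 ≤ m → (1 : ℝ) / (m : ℝ) ^ 2 ≤ f (m ^ 2) := by
    intro m hm
    have hm1 : (1 : ℝ) ≤ (m : ℝ) ^ 2 := by nlinarith [show (1 : ℝ) ≤ m by exact_mod_cast hm]
    have h1 := one_le_zetaMul_sq_re' χ hq2 hm
    have h2 : (1 : ℝ) / (m : ℝ) ^ 2 ≤ ((m ^ 2 : ℕ) : ℝ) ^ (-β) := by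
      push_cast
      rw [one_div, ← Real.rpow_neg_one]
      exact Real.rpow_le_rpow_of_exponent_le hm1 (by linarith)
    have h3 : 0 ≤ ((m ^ 2 : ℕ) : ℝ) ^ (-β) := Real.rpow_nonneg (Nat.cast_nonneg _) _
    calc (1 : ℝ) / (m : ℝ) ^ 2 ≤ 1 * ((m ^ 2 : ℕ) : ℝ) ^ (-β) := by rw [one_mul]; exact h2
      _ ≤ f (m ^ 2) := mul_le_mul_of_nonneg_right h1 h3
  have hsub : ({1, 4, 9, 16, 25, 36} : Finset ℕ) ⊆ Icc 1 X := by
    intro n hn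
    simp only [Finset.mem_insert, Finset.mem_singleton] at hn
    rw [Finset.mem_Icc]; omega
  have hle := Finset.sum_le_sum_of_subset_of_nonneg hsub fun n hn _ => hnonneg n hn
  have h1 := hsq 1 le_rfl
  have h2 := hsq 2 (by norm_num)
  have h3 := hsq 3 (by norm_num)
  have h4 := hsq 4 (by norm_num)
  have h5 := hsq 5 (by norm_num)
  have h6 := hsq 6 (by norm_num)
  norm_num at h1 h2 h3 h4 h5 h6
  rw [Finset.sum_insert (by decide), Finset.sum_insert (by decide), Finset.sum_insert (by decide),
    Finset.sum_insert (by decide), Finset.sum_insert (by decide), Finset.sum_singleton] at hle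
  change f 1 + (f 4 + (f 9 + (f 16 + (f 25 + f 36)))) ≤ ∑ n ∈ Icc 1 X, f n at hle
  linarith

/-! ### The master inequality -/

/-- A real zero of `L(s, χ)`, `χ ≠ χ₀`, lies in `β < 1` (non-vanishing of `L(s,χ)` on `Re s ≥ 1`,
Dirichlet / de la Vallée Poussin). [cite: MontgomeryVaughan2007, §4.3 Thm. 4.9 and §11.2 (L(σ,χ) ≠ 0 for σ ≥ 1)] -/
theorem realZero_lt_one (hχ : χ ≠ 1) {β : ℝ} (hz : χ.LFunction β = 0) : β < 1 := by
  by_contra h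
  push Not at h
  exact DirichletCharacter.LFunction_ne_zero_of_one_le_re χ (Or.inl hχ) (by simpa using h) hz

/-- **Master inequality (hyperbola method at the zero, `X = q⁶`).** For a quadratic `χ ≠ χ₀` mod
`q ≥ 10⁴` and a real zero `β` of `L(s,χ)` with `1 − β ≤ 1/(4 log q)` and the a-priori bound
`1 − β ≥ 1000/q²`: `(1 − β)(1.4913 e^{−6(1−β) log q} − 0.0041) ≤ Re L(1, χ)`.
[cite: MontgomeryVaughan2007, §11.2 (11.10) and Thm. 11.14 (Case A), §2.1] -/
theorem lOne_ge_of_realZero_master (hq : 10 ^ 4 ≤ q) (hχ : χ ≠ 1) (hq2 : χ ^ 2 = 1) {β : ℝ}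
    (hz : χ.LFunction β = 0) (hβ : 1 - 1 / (4 * Real.log q) ≤ β)
    (hrep : 1000 / (q : ℝ) ^ 2 ≤ 1 - β) :
    (1 - β) * (1.4913 / Real.exp (6 * (1 - β) * Real.log q) - 0.0041) ≤ (χ.LFunction 1).re := by
  set L : ℝ := Real.log q with hLdef
  have hqr : (10 : ℝ) ^ 4 ≤ q := by exact_mod_cast hq
  have hq1 : (10000 : ℝ) ≤ q := by linarith [hqr, show (10 : ℝ) ^ 4 = 10000 by norm_num]
  have hq0 : (0 : ℝ) < q := by linarith
  have hL9 : 9 ≤ L := nine_le_log' hq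
  have hL0 : 0 < L := by linarith
  have hLq : L ≤ (q : ℝ) / 1000 := log_le_div_thousand' hq
  have hβ1 : β < 1 := realZero_lt_one χ hχ hz
  set κ : ℝ := 1 - β with hκdef
  have hκ0 : 0 < κ := by rw [hκdef]; linarith
  have hκL : κ * L ≤ 1 / 4 := by
    have h1 : κ ≤ 1 / (4 * L) := by rw [hκdef]; linarith
    calc κ * L ≤ 1 / (4 * L) * L := mul_le_mul_of_nonneg_right h1 hL0.le
      _ = 1 / 4 := by field_simp
  have hβ0 : 0 < β := by
    have : 1 / (4 * L) ≤ 1 / 36 := one_div_le_one_div_of_le (by norm_num) (by linarith)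
    linarith
  -- the hyperbola estimate at `X = q⁶`, `D = q³`
  have hX : 1 ≤ q ^ 6 := Nat.one_le_pow _ _ (by omega)
  have hq2' : 2 ≤ q := le_trans (by norm_num) hq
  have hX36 : 36 ≤ q ^ 6 := le_trans (by norm_num : 36 ≤ 2 ^ 6) (Nat.pow_le_pow_left hq2' 6)
  have hD : Nat.sqrt (q ^ 6) = q ^ 3 := by
    rw [show q ^ 6 = q ^ 3 * q ^ 3 by ring, Nat.sqrt_eq]
  have hpos : 0 ≤ (χ.LFunction β).re := by rw [hz]; simp
  have hmain := sum_re_zetaMul_mul_rpow_sub_main_le_of_nonneg χ hχ hq2 hβ0 hβ1 hpos hX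
  have hG := sum_zetaMul_rpow_ge_squares' χ hq2 hβ1.le hX36
  rw [hD] at hmain
  -- the powers: `u = e^{3κL}`, `X^{1−β} = u²·… = e^{6κL}`, `D^{−β} = u/q³`
  set u : ℝ := Real.exp (3 * κ * L) with hudef
  set W : ℝ := Real.exp (6 * κ * L) with hWdef
  have hu0 : 0 < u := Real.exp_pos _
  have hW0 : 0 < W := Real.exp_pos _
  have hu1 : 1 ≤ u := by rw [hudef]; exact Real.one_le_exp (by positivity)
  have huW : W = u ^ 2 := by rw [hWdef, hudef, ← Real.exp_nat_mul]; ring_nf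
  have hule : u ≤ 2.118 := by
    have h1 : 3 * κ * L ≤ 3 / 4 := by nlinarith
    exact le_trans (Real.exp_le_exp.mpr h1) exp_three_quarters_lt.le
  have hq6r : ((q ^ 6 : ℕ) : ℝ) = (q : ℝ) ^ 6 := by push_cast; ring
  have hq3r : ((q ^ 3 : ℕ) : ℝ) = (q : ℝ) ^ 3 := by push_cast; ring
  have hlog6 : Real.log ((q : ℝ) ^ 6) = 6 * L := by rw [Real.log_pow, ← hLdef]; push_cast; ring
  have hlog3 : Real.log ((q : ℝ) ^ 3) = 3 * L := by rw [Real.log_pow, ← hLdef]; push_cast; ring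
  have hXpow : ((q ^ 6 : ℕ) : ℝ) ^ (1 - β) = W := by
    rw [hq6r, Real.rpow_def_of_pos (by positivity), hlog6, hWdef, ← hκdef]; ring_nf
  have hexp3L : Real.exp (3 * L) = (q : ℝ) ^ 3 := by
    rw [show (3 : ℝ) * L = ((3 : ℕ) : ℝ) * L by push_cast; ring, Real.exp_nat_mul, hLdef,
      Real.exp_log hq0]
  have hDpow : ((q ^ 3 : ℕ) : ℝ) ^ (-β) = u / (q : ℝ) ^ 3 := by
    rw [hq3r, Real.rpow_def_of_pos (by positivity), hlog3, hudef, ← hexp3L, ← Real.exp_sub]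
    congr 1; rw [hκdef]; ring
  have hD1pow : ((q ^ 3 : ℕ) : ℝ) ^ (1 - β) = u := by
    rw [hq3r, Real.rpow_def_of_pos (by positivity), hlog3, hudef, ← hκdef]; ring_nf
  rw [hXpow, hDpow] at hmain
  set P : ℝ := ∑ d ∈ Icc 1 (q ^ 3), (χ (d : ZMod q)).re / d with hP
  set A : ℝ := ∑ e ∈ Icc 1 (q ^ 3), (e : ℝ) ^ (-β) with hA
  set G : ℝ := ∑ n ∈ Icc 1 (q ^ 6), (χ.zetaMul n).re * (n : ℝ) ^ (-β) with hGdef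
  -- `A ≤ 1 + 3uL`
  have hAle : A ≤ 1 + u * (3 * L) := by
    have h := sum_Icc_rpow_le_log hβ0.le hβ1 (N := q ^ 3) (Nat.one_le_pow _ _ (by omega))
    rw [hD1pow, hq3r, hlog3] at h
    rw [hA]; exact h
  have hA0 : 0 ≤ A := Finset.sum_nonneg fun e _ => Real.rpow_nonneg (Nat.cast_nonneg e) _
  -- `P ≤ Re L(1,χ) + 2q/(q³+1)`
  have hPle : P ≤ (χ.LFunction 1).re + 2 * q / ((q : ℝ) ^ 3 + 1) := by
    have hWt := CharacterTails.norm_sum_Icc_div_sub_LFunction_one_le χ hχ (W := 2 * q)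
      (N := q ^ 3) fun n => norm_sum_Ioc_apply_le χ hχ (q ^ 3) n
    have e : ∑ n ∈ Icc 1 (q ^ 3), χ (n : ZMod q) / n = ((P : ℝ) : ℂ) := by
      rw [hP, Complex.ofReal_sum]
      refine Finset.sum_congr rfl fun n _ => ?_
      rw [apply_eq_ofReal_re χ hq2]
      push_cast
      simp
    rw [e] at hWt
    have hre := Complex.abs_re_le_norm (((P : ℝ) : ℂ) - χ.LFunction 1)
    rw [Complex.sub_re, Complex.ofReal_re] at hre
    have h3 := (abs_le.mp (hre.trans hWt)).2
    push_cast at h3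
    linarith
  -- make the abbreviations opaque (keeps `field_simp`/`linarith` fast)
  clear_value G P A u W κ L
  -- elementary sizes
  have hq2pos : (0 : ℝ) < (q : ℝ) ^ 2 := by positivity
  have hq3pos : (0 : ℝ) < (q : ℝ) ^ 3 := by positivity
  have hinvq2 : 1 / (q : ℝ) ^ 2 ≤ κ / 1000 := by
    rw [div_le_div_iff₀ hq2pos (by norm_num)]
    have := (div_le_iff₀ hq2pos).mp hrep
    linarith
  have hT1 : 2 * q / ((q : ℝ) ^ 3 + 1) ≤ 2 / (q : ℝ) ^ 2 := by
    rw [div_le_div_iff₀ (by positivity) hq2pos]; nlinarith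
  -- `(q+1)(1 + 3uL) ≤ 6.5e-7 · q³`
  have hT2 : ((q : ℝ) + 1) * (1 + u * (3 * L)) ≤ 0.00000065 * (q : ℝ) ^ 3 := by
    have h1 : (q : ℝ) + 1 ≤ 1.0001 * q := by linarith
    have h2a : u * (3 * L) ≤ 2.118 * (3 * L) := mul_le_mul_of_nonneg_right hule (by positivity)
    have h2 : 1 + u * (3 * L) ≤ 0.00646 * q := by linarith
    have h3 : (1 : ℝ) ≤ (q : ℝ) / 10000 := by rw [le_div_iff₀ (by norm_num)]; linarith
    have h4 : (0 : ℝ) ≤ 0.006460646 * (q : ℝ) ^ 2 := by positivity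
    calc ((q : ℝ) + 1) * (1 + u * (3 * L)) ≤ (1.0001 * q) * (0.00646 * q) :=
          mul_le_mul h1 h2 (by positivity) (by positivity)
      _ = 0.006460646 * (q : ℝ) ^ 2 * 1 := by ring
      _ ≤ 0.006460646 * (q : ℝ) ^ 2 * ((q : ℝ) / 10000) :=
          mul_le_mul_of_nonneg_left h3 h4
      _ = 0.0000006460646 * (q : ℝ) ^ 3 := by ring
      _ ≤ 0.00000065 * (q : ℝ) ^ 3 := mul_le_mul_of_nonneg_right (by norm_num) hq3pos.le
  -- from `hmain`: `G ≤ (W/κ) P + 2 (u/q³) ((q+1) A + q/κ)`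
  have hmain' : G ≤ W / κ * P + 2 * (u / (q : ℝ) ^ 3) * ((q + 1) * A + q / κ) := by
    rw [hκdef]
    exact sub_le_iff_le_add'.mp hmain
  clear hmain
  -- multiply by `κ/W`
  have hκW : 0 < κ / W := div_pos hκ0 hW0
  have hstep : 1.4913 * (κ / W) ≤
      P + κ * (2 * u * ((q + 1) * A)) / (W * (q : ℝ) ^ 3) + 2 * u / (W * (q : ℝ) ^ 2) := by
    have h1 : G * (κ / W) ≤
        (W / κ * P + 2 * (u / (q : ℝ) ^ 3) * ((q + 1) * A + q / κ)) * (κ / W) :=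
      mul_le_mul_of_nonneg_right hmain' hκW.le
    have h2 : (W / κ * P + 2 * (u / (q : ℝ) ^ 3) * ((q + 1) * A + q / κ)) * (κ / W) =
        P + κ * (2 * u * ((q + 1) * A)) / (W * (q : ℝ) ^ 3) + 2 * u / (W * (q : ℝ) ^ 2) := by
      field_simp
      ring
    have h3 : 1.4913 * (κ / W) ≤ G * (κ / W) := mul_le_mul_of_nonneg_right hG hκW.le
    linarith
  -- `u/W = 1/u ≤ 1`
  have huW1 : u / W ≤ 1 := by
    rw [huW, div_le_one (by positivity)]
    exact le_self_pow₀ hu1 two_ne_zero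
  have hE2 : κ * (2 * u * ((q + 1) * A)) / (W * (q : ℝ) ^ 3) ≤ κ * 0.0000013 := by
    have hA' : ((q : ℝ) + 1) * A ≤ 0.00000065 * (q : ℝ) ^ 3 :=
      le_trans (mul_le_mul_of_nonneg_left hAle (by positivity)) hT2
    have h1 : κ * (2 * u * ((q + 1) * A)) / (W * (q : ℝ) ^ 3) =
        κ * (u / W) * (2 * (((q : ℝ) + 1) * A) / (q : ℝ) ^ 3) := by
      field_simp
    rw [h1]
    have h2 : 2 * (((q : ℝ) + 1) * A) / (q : ℝ) ^ 3 ≤ 0.0000013 := by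
      rw [div_le_iff₀ hq3pos]; linarith
    have h3 : κ * (u / W) ≤ κ := mul_le_of_le_one_right hκ0.le huW1
    calc κ * (u / W) * (2 * (((q : ℝ) + 1) * A) / (q : ℝ) ^ 3)
        ≤ κ * (u / W) * 0.0000013 := mul_le_mul_of_nonneg_left h2 (by positivity)
      _ ≤ κ * 0.0000013 := mul_le_mul_of_nonneg_right h3 (by norm_num)
  have hE3 : 2 * u / (W * (q : ℝ) ^ 2) ≤ 2 / (q : ℝ) ^ 2 := by
    have h1 : 2 * u / (W * (q : ℝ) ^ 2) = (u / W) * (2 / (q : ℝ) ^ 2) := by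
      field_simp
    rw [h1]
    calc (u / W) * (2 / (q : ℝ) ^ 2) ≤ 1 * (2 / (q : ℝ) ^ 2) :=
          mul_le_mul_of_nonneg_right huW1 (by positivity)
      _ = 2 / (q : ℝ) ^ 2 := one_mul _
  -- assemble: `1.4913 κ/W ≤ Re L(1,χ) + 0.0041 κ`
  have hfinal : 1.4913 * (κ / W) ≤ (χ.LFunction 1).re + 0.0041 * κ := by
    have h4 : 4 / (q : ℝ) ^ 2 ≤ 4 * (κ / 1000) := by
      have := hinvq2
      rw [show (4 : ℝ) / (q : ℝ) ^ 2 = 4 * (1 / (q : ℝ) ^ 2) by ring]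
      linarith
    have h2q : 2 * q / ((q : ℝ) ^ 3 + 1) + 2 / (q : ℝ) ^ 2 ≤ 4 / (q : ℝ) ^ 2 := by
      rw [show (4 : ℝ) / (q : ℝ) ^ 2 = 2 / (q : ℝ) ^ 2 + 2 / (q : ℝ) ^ 2 by ring]
      linarith
    linarith
  have hgoal : κ * (1.4913 / W - 0.0041) = 1.4913 * (κ / W) - 0.0041 * κ := by ring
  rw [hgoal]
  linarith

/-! ### The a-priori bound `1 − β ≥ 1000/q²` for primitive quadratic `χ` (kernel repulsion) -/

/-- A primitive character mod `q ≥ 2` is non-principal. [folklore] -/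
private theorem ne_one_of_isPrimitive_of_two_le (hq : 2 ≤ q) (hprim : χ.IsPrimitive) : χ ≠ 1 := by
  rintro rfl
  rw [DirichletCharacter.isPrimitive_def, DirichletCharacter.conductor_one] at hprim
  omega

/-- **`1 − β ≥ 1000/q²`** for every real zero `β` of a primitive quadratic `L(s,χ)`, `q ≥ 10⁴` — from
the kernel repulsion `1 − β ≥ π/(√q log²q)` (`one_sub_realZero_ge_pi`) and `log q ≤ 4 q^{1/4}`.
[cite: MontgomeryVaughan2007, §11.2 (11.10)] -/
theorem thousand_div_sq_le_one_sub_realZero (hq : 10 ^ 4 ≤ q) (hprim : χ.IsPrimitive)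
    (hquad : χ.IsQuadratic) {β : ℝ} (hz : χ.LFunction β = 0) :
    1000 / (q : ℝ) ^ 2 ≤ 1 - β := by
  have hrep := one_sub_realZero_ge_pi (le_trans (by norm_num) hq) hprim hquad hz
  refine le_trans ?_ hrep
  have hqr : (10 : ℝ) ^ 4 ≤ q := by exact_mod_cast hq
  have hq1 : (10000 : ℝ) ≤ q := by linarith [hqr, show (10 : ℝ) ^ 4 = 10000 by norm_num]
  have hq0 : (0 : ℝ) < q := by linarith
  have hL9 : 9 ≤ Real.log q := nine_le_log' hq
  have hL0 : 0 ≤ Real.log q := by linarith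
  set r : ℝ := (q : ℝ) ^ (1 / 4 : ℝ) with hr
  have hr0 : 0 < r := Real.rpow_pos_of_pos hq0 _
  have hLr : Real.log q ≤ 4 * r := by
    have h := Real.log_le_rpow_div hq0.le (by norm_num : (0 : ℝ) < 1 / 4)
    calc Real.log q ≤ (q : ℝ) ^ (1 / 4 : ℝ) / (1 / 4) := h
      _ = 4 * r := by rw [hr]; ring
  have hr2 : r ^ 2 = Real.sqrt q := by
    rw [hr, ← Real.rpow_natCast, ← Real.rpow_mul hq0.le, Real.sqrt_eq_rpow]
    norm_num
  have hsq : Real.sqrt q * Real.sqrt q = q := Real.mul_self_sqrt hq0.le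
  have hsqrt0 : 0 < Real.sqrt q := Real.sqrt_pos.mpr hq0
  have hL2 : Real.log q ^ 2 ≤ 16 * r ^ 2 := by
    have := pow_le_pow_left₀ hL0 hLr 2
    linarith [show (4 * r) ^ 2 = 16 * r ^ 2 by ring]
  have hden : Real.sqrt q * Real.log q ^ 2 ≤ 16 * q := by
    calc Real.sqrt q * Real.log q ^ 2 ≤ Real.sqrt q * (16 * r ^ 2) :=
          mul_le_mul_of_nonneg_left hL2 hsqrt0.le
      _ = 16 * (Real.sqrt q * Real.sqrt q) := by rw [hr2]; ring
      _ = 16 * q := by rw [hsq]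
  have hden0 : 0 < Real.sqrt q * Real.log q ^ 2 := by positivity
  rw [div_le_div_iff₀ (by positivity) hden0]
  have hpi : 3 < Real.pi := Real.pi_gt_three
  have h1 : 1000 * (Real.sqrt q * Real.log q ^ 2) ≤ 16000 * q := by linarith
  have h2 : (16000 : ℝ) * q ≤ Real.pi * (q : ℝ) ^ 2 := by nlinarith
  linarith

/-! ### The three windows -/

/-- **`L(1,χ) ≥ 0.81 (1 − β)` (window `1/(10 log q)`, kernel).** For a primitive quadratic `χ` mod
`q ≥ 10⁴` and a real zero `β ≥ 1 − 1/(10 log q)` of `L(s,χ)`: `0.81 (1 − β) ≤ Re L(1,χ) = L(1,χ)`.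
Print comparator: Benli–Goel–Twiss–Zaman, Lemma 2.9, `0.72 (1 − β₁) ≤ L(1,χ₁)` for `q > 4·10⁵`.
[cite: MontgomeryVaughan2007, §11.2 (11.10)] [cite: BenliGoelTwissZaman2025, Lemma 2.9] -/
theorem lOne_ge_of_realZero_tenth (hq : 10 ^ 4 ≤ q) (hprim : χ.IsPrimitive)
    (hquad : χ.IsQuadratic) {β : ℝ} (hz : χ.LFunction β = 0)
    (hβ : 1 - 1 / (10 * Real.log q) ≤ β) : 0.81 * (1 - β) ≤ (χ.LFunction 1).re := by
  have hL9 : 9 ≤ Real.log q := nine_le_log' hq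
  have hL0 : 0 < Real.log q := by linarith
  have hne : χ ≠ 1 := ne_one_of_isPrimitive_of_two_le χ (le_trans (by norm_num) hq) hprim
  have hβ4 : 1 - 1 / (4 * Real.log q) ≤ β := by
    have : 1 / (10 * Real.log q) ≤ 1 / (4 * Real.log q) :=
      one_div_le_one_div_of_le (by positivity) (by linarith)
    linarith
  have hm := lOne_ge_of_realZero_master χ hq hne hquad.sq_eq_one hz hβ4
    (thousand_div_sq_le_one_sub_realZero χ hq hprim hquad hz)
  have hκ0 : 0 < 1 - β := by linarith [realZero_lt_one χ hne hz]
  have h6 : 6 * (1 - β) * Real.log q ≤ 3 / 5 := by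
    have h1 : 1 - β ≤ 1 / (10 * Real.log q) := by linarith
    have h2 : (1 - β) * Real.log q ≤ 1 / (10 * Real.log q) * Real.log q :=
      mul_le_mul_of_nonneg_right h1 hL0.le
    have h3 : 1 / (10 * Real.log q) * Real.log q = 1 / 10 := by field_simp
    linarith
  have hW : Real.exp (6 * (1 - β) * Real.log q) ≤ 1.823 :=
    le_trans (Real.exp_le_exp.mpr h6) exp_three_fifths_lt.le
  have hdiv : 1.4913 / 1.823 ≤ 1.4913 / Real.exp (6 * (1 - β) * Real.log q) :=
    div_le_div_of_nonneg_left (by norm_num) (Real.exp_pos _) hW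
  have hc : (0.81 : ℝ) ≤ 1.4913 / Real.exp (6 * (1 - β) * Real.log q) - 0.0041 := by
    have : (0.81 : ℝ) + 0.0041 ≤ 1.4913 / 1.823 := by norm_num
    linarith
  calc 0.81 * (1 - β) = (1 - β) * 0.81 := by ring
    _ ≤ (1 - β) * (1.4913 / Real.exp (6 * (1 - β) * Real.log q) - 0.0041) :=
        mul_le_mul_of_nonneg_left hc hκ0.le
    _ ≤ (χ.LFunction 1).re := hm

/-- **`L(1,χ) ≥ 1.27 (1 − β)` (window `1/(40 log q)`, kernel)** — primitive quadratic `χ` mod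
`q ≥ 10⁴`, real zero `β ≥ 1 − 1/(40 log q)`. [cite: MontgomeryVaughan2007, §11.2 (11.10)] -/
theorem lOne_ge_of_realZero_fortieth (hq : 10 ^ 4 ≤ q) (hprim : χ.IsPrimitive)
    (hquad : χ.IsQuadratic) {β : ℝ} (hz : χ.LFunction β = 0)
    (hβ : 1 - 1 / (40 * Real.log q) ≤ β) : 1.27 * (1 - β) ≤ (χ.LFunction 1).re := by
  have hL9 : 9 ≤ Real.log q := nine_le_log' hq
  have hL0 : 0 < Real.log q := by linarith
  have hne : χ ≠ 1 := ne_one_of_isPrimitive_of_two_le χ (le_trans (by norm_num) hq) hprim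
  have hβ4 : 1 - 1 / (4 * Real.log q) ≤ β := by
    have : 1 / (40 * Real.log q) ≤ 1 / (4 * Real.log q) :=
      one_div_le_one_div_of_le (by positivity) (by linarith)
    linarith
  have hm := lOne_ge_of_realZero_master χ hq hne hquad.sq_eq_one hz hβ4
    (thousand_div_sq_le_one_sub_realZero χ hq hprim hquad hz)
  have hκ0 : 0 < 1 - β := by linarith [realZero_lt_one χ hne hz]
  have h6 : 6 * (1 - β) * Real.log q ≤ 3 / 20 := by
    have h1 : 1 - β ≤ 1 / (40 * Real.log q) := by linarith
    have h2 : (1 - β) * Real.log q ≤ 1 / (40 * Real.log q) * Real.log q :=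
      mul_le_mul_of_nonneg_right h1 hL0.le
    have h3 : 1 / (40 * Real.log q) * Real.log q = 1 / 40 := by field_simp
    linarith
  have hW : Real.exp (6 * (1 - β) * Real.log q) ≤ 1.1625 :=
    le_trans (Real.exp_le_exp.mpr h6) exp_three_twentieths_lt.le
  have hdiv : 1.4913 / 1.1625 ≤ 1.4913 / Real.exp (6 * (1 - β) * Real.log q) :=
    div_le_div_of_nonneg_left (by norm_num) (Real.exp_pos _) hW
  have hc : (1.27 : ℝ) ≤ 1.4913 / Real.exp (6 * (1 - β) * Real.log q) - 0.0041 := by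
    have : (1.27 : ℝ) + 0.0041 ≤ 1.4913 / 1.1625 := by norm_num
    linarith
  calc 1.27 * (1 - β) = (1 - β) * 1.27 := by ring
    _ ≤ (1 - β) * (1.4913 / Real.exp (6 * (1 - β) * Real.log q) - 0.0041) :=
        mul_le_mul_of_nonneg_left hc hκ0.le
    _ ≤ (χ.LFunction 1).re := hm

/-- **`L(1,χ) ≥ 0.32 (1 − β)` (window `1/(4 log q)`, kernel)** — primitive quadratic `χ` mod
`q ≥ 10⁴`, real zero `β ≥ 1 − 1/(4 log q)` (the Hecke window of `HeckeLOneLowerBoundExplicit.lean`).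
[cite: MontgomeryVaughan2007, §11.2 (11.10)] -/
theorem lOne_ge_of_realZero_quarter (hq : 10 ^ 4 ≤ q) (hprim : χ.IsPrimitive)
    (hquad : χ.IsQuadratic) {β : ℝ} (hz : χ.LFunction β = 0)
    (hβ : 1 - 1 / (4 * Real.log q) ≤ β) : 0.32 * (1 - β) ≤ (χ.LFunction 1).re := by
  have hL9 : 9 ≤ Real.log q := nine_le_log' hq
  have hL0 : 0 < Real.log q := by linarith
  have hne : χ ≠ 1 := ne_one_of_isPrimitive_of_two_le χ (le_trans (by norm_num) hq) hprim
  have hm := lOne_ge_of_realZero_master χ hq hne hquad.sq_eq_one hz hβ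
    (thousand_div_sq_le_one_sub_realZero χ hq hprim hquad hz)
  have hκ0 : 0 < 1 - β := by linarith [realZero_lt_one χ hne hz]
  have h6 : 6 * (1 - β) * Real.log q ≤ 3 / 2 := by
    have h1 : 1 - β ≤ 1 / (4 * Real.log q) := by linarith
    have h2 : (1 - β) * Real.log q ≤ 1 / (4 * Real.log q) * Real.log q :=
      mul_le_mul_of_nonneg_right h1 hL0.le
    have h3 : 1 / (4 * Real.log q) * Real.log q = 1 / 4 := by field_simp
    linarith
  have hW : Real.exp (6 * (1 - β) * Real.log q) ≤ 4.49 :=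
    le_trans (Real.exp_le_exp.mpr h6) exp_three_halves_lt.le
  have hdiv : 1.4913 / 4.49 ≤ 1.4913 / Real.exp (6 * (1 - β) * Real.log q) :=
    div_le_div_of_nonneg_left (by norm_num) (Real.exp_pos _) hW
  have hc : (0.32 : ℝ) ≤ 1.4913 / Real.exp (6 * (1 - β) * Real.log q) - 0.0041 := by
    have : (0.32 : ℝ) + 0.0041 ≤ 1.4913 / 4.49 := by norm_num
    linarith
  calc 0.32 * (1 - β) = (1 - β) * 0.32 := by ring
    _ ≤ (1 - β) * (1.4913 / Real.exp (6 * (1 - β) * Real.log q) - 0.0041) :=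
        mul_le_mul_of_nonneg_left hc hκ0.le
    _ ≤ (χ.LFunction 1).re := hm

/-! ### The explicit (11.10) and the Siegel-zero reading -/

/-- **The explicit two-sided (11.10), kernel**: for a primitive quadratic `χ` mod `q ≥ 10⁴` and a real
zero `β ≥ 1 − 1/(10 log q)`: `0.81 (1 − β) ≤ L(1,χ) ≤ 55 (1 − β) log²q` (upper half:
`norm_LFunction_one_le_mul_log_sq`). [cite: MontgomeryVaughan2007, §11.2 (11.10)] -/
theorem norm_LFunction_one_two_sided_of_realZero (hq : 10 ^ 4 ≤ q) (hprim : χ.IsPrimitive)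
    (hquad : χ.IsQuadratic) {β : ℝ} (hz : χ.LFunction β = 0)
    (hβ : 1 - 1 / (10 * Real.log q) ≤ β) :
    0.81 * (1 - β) ≤ ‖χ.LFunction 1‖ ∧ ‖χ.LFunction 1‖ ≤ 55 * (1 - β) * Real.log q ^ 2 := by
  have hL9 : 9 ≤ Real.log q := nine_le_log' hq
  have hne : χ ≠ 1 := ne_one_of_isPrimitive_of_two_le χ (le_trans (by norm_num) hq) hprim
  have hβ4 : 1 - 1 / (4 * Real.log q) ≤ β := by
    have : 1 / (10 * Real.log q) ≤ 1 / (4 * Real.log q) :=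
      one_div_le_one_div_of_le (by positivity) (by linarith)
    linarith
  refine ⟨le_trans (lOne_ge_of_realZero_tenth χ hq hprim hquad hz hβ) (Complex.re_le_norm _), ?_⟩
  exact norm_LFunction_one_le_mul_log_sq (le_trans (by norm_num) hq) χ hne hβ4 hz

/-- **A Siegel zero of quality `η` leaves `L(1,χ) ≥ 0.81/(η log q)` (kernel).** If `χ` mod `q ≥ 10⁴`
carries a Tao–Teräväinen Siegel zero of quality `η` (`χ` primitive quadratic,
`L(1 − 1/(η log q), χ) = 0`, `η ≥ 10`), then `‖L(1,χ)‖ ≥ 0.81/(η log q)`; with the kernel upper half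
`‖L(1,χ)‖ ≤ 55 log q/η` this pins `L(1,χ)` to the zero within the factor `68 log²q`.
[cite: TaoTeravainen2021, Definition 1.4] [cite: MontgomeryVaughan2007, §11.2 (11.10)] -/
theorem norm_LFunction_one_ge_of_isSiegelZero (hq : 10 ^ 4 ≤ q) {η : ℝ} (hS : IsSiegelZero χ η) :
    0.81 / (η * Real.log q) ≤ ‖χ.LFunction 1‖ := by
  obtain ⟨hprim, hquad, h10, hzero⟩ := hS
  have hL9 : 9 ≤ Real.log q := nine_le_log' hq
  have hL0 : 0 < Real.log q := by linarith
  have hη0 : 0 < η := by linarith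
  set β : ℝ := 1 - 1 / (η * Real.log q) with hβdef
  have hκ : 1 - β = 1 / (η * Real.log q) := by rw [hβdef]; ring
  have hβ : 1 - 1 / (10 * Real.log q) ≤ β := by
    have : 1 / (η * Real.log q) ≤ 1 / (10 * Real.log q) :=
      one_div_le_one_div_of_le (by positivity) (mul_le_mul_of_nonneg_right h10 hL0.le)
    rw [hβdef]; linarith
  have h := lOne_ge_of_realZero_tenth χ hq hprim hquad hzero hβ
  rw [hκ] at h
  calc 0.81 / (η * Real.log q) = 0.81 * (1 / (η * Real.log q)) := by ring
    _ ≤ (χ.LFunction 1).re := h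
    _ ≤ ‖χ.LFunction 1‖ := Complex.re_le_norm _

/-! ### The explicit Hecke converse: small `L(1,χ)` forces a zero of controlled distance -/

/-- **Small `L(1,χ)` ⇒ a real zero close to `1`, explicitly (kernel).** For a primitive quadratic `χ`
mod `q ≥ 10⁴`: if `‖L(1,χ)‖ < 1/(8 log q)`, then `L(s,χ)` has a real zero `β` with
`1 − 1/(4 log q) ≤ β < 1` and `0.32 (1 − β) ≤ ‖L(1,χ)‖` — i.e. `1 − β ≤ 3.2 ‖L(1,χ)‖`. (The kernel
Hecke lemma `Hecke.lOne_ge_eighth_of_noRealZero_near_one` supplies the zero; the quarter-window bound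
its distance.) [cite: MontgomeryVaughan2007, §11.2 Thm. 11.14 (Case A) and (11.10)] -/
theorem exists_realZero_of_lOne_lt (hq : 10 ^ 4 ≤ q) (hprim : χ.IsPrimitive)
    (hquad : χ.IsQuadratic) (hlt : ‖χ.LFunction 1‖ < 1 / (8 * Real.log q)) :
    ∃ β : ℝ, χ.LFunction β = 0 ∧ 1 - 1 / (4 * Real.log q) ≤ β ∧ β < 1 ∧
      0.32 * (1 - β) ≤ ‖χ.LFunction 1‖ := by
  have hne : χ ≠ 1 := ne_one_of_isPrimitive_of_two_le χ (le_trans (by norm_num) hq) hprim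
  by_cases hex : ∃ σ : ℝ, 1 - 1 / (4 * Real.log q) ≤ σ ∧ σ ≤ 1 ∧ χ.LFunction σ = 0
  · obtain ⟨σ, hσ, -, hz⟩ := hex
    exact ⟨σ, hz, hσ, realZero_lt_one χ hne hz,
      le_trans (lOne_ge_of_realZero_quarter χ hq hprim hquad hz hσ) (Complex.re_le_norm _)⟩
  · push Not at hex
    have h := lOne_ge_eighth_of_noRealZero_near_one χ hq hne hquad.sq_eq_one
      fun σ h1 h2 => hex σ h1 h2
    have := Complex.re_le_norm (χ.LFunction 1)
    linarith

/-- **Small `η_χ = L(1,χ) log q` ⇒ a Siegel zero of explicit quality (kernel; the §1 dictionary line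
«small `L(1,χ)` ⇒ Siegel zero», quantified).** For a primitive quadratic `χ` mod `q ≥ 10⁴` and
`0 < ε ≤ 0.032`: if `‖L(1,χ)‖ log q ≤ ε` then `IsSiegelZero χ η` for some `η ≥ 0.32/ε` (`≥ 10`).
[cite: TaoTeravainen2021, Definition 1.4] [cite: MontgomeryVaughan2007, §11.2 (11.10)] -/
theorem exists_isSiegelZero_of_lOne_mul_log_le (hq : 10 ^ 4 ≤ q) (hprim : χ.IsPrimitive)
    (hquad : χ.IsQuadratic) {ε : ℝ} (hε0 : 0 < ε) (hε : ε ≤ 0.032)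
    (hsmall : ‖χ.LFunction 1‖ * Real.log q ≤ ε) :
    ∃ η : ℝ, 0.32 / ε ≤ η ∧ IsSiegelZero χ η := by
  have hL9 : 9 ≤ Real.log q := nine_le_log' hq
  have hL0 : 0 < Real.log q := by linarith
  have hne : χ ≠ 1 := ne_one_of_isPrimitive_of_two_le χ (le_trans (by norm_num) hq) hprim
  have hN0 : 0 < ‖χ.LFunction 1‖ :=
    norm_pos_iff.mpr (DirichletCharacter.LFunction_ne_zero_of_one_le_re χ (Or.inl hne) (by simp))
  -- `‖L(1,χ)‖ < 1/(8 log q)`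
  have hlt : ‖χ.LFunction 1‖ < 1 / (8 * Real.log q) := by
    rw [lt_div_iff₀ (by positivity)]
    nlinarith
  obtain ⟨β, hz, hβ, hβ1, hbound⟩ := exists_realZero_of_lOne_lt χ hq hprim hquad hlt
  have hκ0 : 0 < 1 - β := by linarith
  set η : ℝ := 1 / ((1 - β) * Real.log q) with hηdef
  have hη0 : 0 < η := by positivity
  -- `η ≥ 0.32/ε`: `(1 − β) log q ≤ ‖L(1,χ)‖ log q / 0.32 ≤ ε/0.32`
  have hκL : (1 - β) * Real.log q ≤ ε / 0.32 := by
    rw [le_div_iff₀ (by norm_num)]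
    have := mul_le_mul_of_nonneg_right hbound hL0.le
    nlinarith
  have hηge : 0.32 / ε ≤ η := by
    rw [hηdef, div_le_div_iff₀ hε0 (by positivity)]
    have := mul_le_mul_of_nonneg_left hκL (by norm_num : (0 : ℝ) ≤ 0.32)
    have e : 0.32 * (ε / 0.32) = ε := by field_simp
    linarith
  have h10 : 10 ≤ η := by
    have : (10 : ℝ) ≤ 0.32 / ε := by
      rw [le_div_iff₀ hε0]; linarith
    linarith
  refine ⟨η, hηge, hprim, hquad, h10, ?_⟩
  have e : (1 - 1 / (η * Real.log q) : ℝ) = β := by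
    rw [hηdef]
    field_simp
    ring
  rw [e]
  exact hz

end Literature.NumberTheory.LFunctions.RealZeroRepulsion

/-! ### I.1 kernel line, LOWER half: the class number under a Landau–Siegel zero, from below -/

namespace Literature.NumberTheory.LFunctions

open Literature.NumberTheory.QuadraticFields Literature.NumberTheory.QuadraticFields.Quadratic
open _root_.NumberField _root_.NumberField.Units Module

variable {K : Type*} [Field K] [NumberField K]

/-- For a quadratic field with odd discriminant, `|d_K|` is odd and squarefree, so the Kronecker
character `jacobiChar |d_K|` is primitive (copy of the private lemma of `SiegelZeroClassNumberBound.lean`).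
[cite: MontgomeryVaughan2007, Theorem 9.13] -/
private theorem isPrimitive_jacobiChar_natAbs_discr' (h2 : finrank ℚ K = 2)
    (hodd : Odd (NumberField.discr K)) : (jacobiChar (NumberField.discr K).natAbs).IsPrimitive := by
  have hoddN : Odd (NumberField.discr K).natAbs := Int.natAbs_odd.mpr hodd
  have hsqN : Squarefree (NumberField.discr K).natAbs := by
    rcases isFundamentalDiscriminant_discr (K := K) h2 with ⟨-, hsqf, -⟩ | ⟨h4, -, -⟩
    · exact Int.squarefree_natAbs.mpr hsqf
    · exfalso
      rcases hodd with ⟨k, hk⟩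
      omega
  exact isPrimitive_jacobiChar hoddN hsqN

/-- **`h_K ≥ (0.81/(2π)) · w_K · √q · (1 − β)` (kernel, fact-free).** For an imaginary quadratic field
`K` with odd `d_K`, `q = |d_K| ≥ 10⁴`, and a real zero `β ≥ 1 − 1/(10 log q)` of `L(s, χ_{d_K})`
(`χ_{d_K}` = the Jacobi character mod `q`, primitive quadratic): the class number formula
`L(1,χ_{d_K}) = 2π h_K/(w_K √q)` and `RealZeroRepulsion.lOne_ge_of_realZero_tenth`. Print comparator:
`0.36/π · w_K √q (1−β₁) ≤ h_K` for `q > 4·10⁵` (`classNumber_bounds_of_landauSiegelZero`, modulo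
`BGTZ2025.lemma29`). [cite: BenliGoelTwissZaman2025, Lemma 2.9] [cite: NeukirchANT1999, Ch. VII §5 (5.11)] -/
theorem classNumber_ge_of_realZero_explicit (h2 : finrank ℚ K = 2)
    (hodd : Odd (NumberField.discr K)) (hd : NumberField.discr K < 0)
    (hq : 10 ^ 4 ≤ (NumberField.discr K).natAbs) {β : ℝ}
    (hβ : 1 - 1 / (10 * Real.log (NumberField.discr K).natAbs) ≤ β)
    (hz : (jacobiChar (NumberField.discr K).natAbs).LFunction β = 0) :
    0.81 / (2 * Real.pi) * (torsionOrder K : ℝ) * Real.sqrt (NumberField.discr K).natAbs * (1 - β) ≤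
      (classNumber K : ℝ) := by
  haveI : NeZero (NumberField.discr K).natAbs := ⟨by omega⟩
  have hprim := isPrimitive_jacobiChar_natAbs_discr' h2 hodd
  have hlow := RealZeroRepulsion.lOne_ge_of_realZero_tenth (jacobiChar (NumberField.discr K).natAbs)
    hq hprim isQuadratic_jacobiChar hz hβ
  have hcnf := LFunction_jacobiChar_one_eq_of_discr_neg h2 hodd hd
  have habs : |(NumberField.discr K : ℝ)| = ((NumberField.discr K).natAbs : ℝ) := by
    rw [← Int.cast_abs, Int.abs_eq_natAbs, Int.cast_natCast]
  rw [habs] at hcnf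
  have hw : (0 : ℝ) < (torsionOrder K : ℝ) := by exact_mod_cast torsionOrder_pos K
  have hq0 : (0 : ℝ) < Real.sqrt ((NumberField.discr K).natAbs : ℝ) :=
    Real.sqrt_pos.mpr (by exact_mod_cast (show 0 < (NumberField.discr K).natAbs by omega))
  have hden : (0 : ℝ) < torsionOrder K * Real.sqrt ((NumberField.discr K).natAbs : ℝ) :=
    mul_pos hw hq0
  have hpi : 0 < Real.pi := Real.pi_pos
  have hre : ((jacobiChar (NumberField.discr K).natAbs).LFunction 1).re =
      2 * Real.pi * classNumber K /
        (torsionOrder K * Real.sqrt ((NumberField.discr K).natAbs : ℝ)) := by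
    rw [hcnf, Complex.ofReal_re]
  rw [hre, le_div_iff₀ hden] at hlow
  rw [show 0.81 / (2 * Real.pi) * (torsionOrder K : ℝ) * Real.sqrt (NumberField.discr K).natAbs *
        (1 - β) = (0.81 * (1 - β) * (torsionOrder K * Real.sqrt ((NumberField.discr K).natAbs : ℝ))) /
          (2 * Real.pi) by ring, div_le_iff₀ (by positivity)]
  linarith

/-- **`h_K ≥ (0.81/π) √q (1 − β)`** — the previous bound with `w_K = 2` (`d_K < −4`).
[cite: BenliGoelTwissZaman2025, Lemma 2.9] [cite: NeukirchANT1999, Ch. VII §5 (5.11)] -/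
theorem classNumber_ge_of_realZero_explicit_v3 (h2 : finrank ℚ K = 2)
    (hodd : Odd (NumberField.discr K)) (hd : NumberField.discr K < 0)
    (hq : 10 ^ 4 ≤ (NumberField.discr K).natAbs) {β : ℝ}
    (hβ : 1 - 1 / (10 * Real.log (NumberField.discr K).natAbs) ≤ β)
    (hz : (jacobiChar (NumberField.discr K).natAbs).LFunction β = 0) :
    0.81 / Real.pi * Real.sqrt (NumberField.discr K).natAbs * (1 - β) ≤ (classNumber K : ℝ) := by
  have h := classNumber_ge_of_realZero_explicit h2 hodd hd hq hβ hz
  have hd4 : NumberField.discr K < -4 := by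
    have : (10 ^ 4 : ℤ) ≤ ((NumberField.discr K).natAbs : ℤ) := by exact_mod_cast hq
    omega
  have hw : torsionOrder K = 2 := torsionOrder_eq_two_of_discr_lt_neg_four h2 hd4
  rw [hw] at h
  push_cast at h
  have e : 0.81 / (2 * Real.pi) * (2 : ℝ) = 0.81 / Real.pi := by field_simp
  calc 0.81 / Real.pi * Real.sqrt (NumberField.discr K).natAbs * (1 - β)
      = 0.81 / (2 * Real.pi) * 2 * Real.sqrt (NumberField.discr K).natAbs * (1 - β) := by rw [e]
    _ ≤ (classNumber K : ℝ) := h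

/-- **Two-sided, kernel**: for an imaginary quadratic `K`, odd `d_K`, `q = |d_K| ≥ 10⁴`, and a real zero
`β ≥ 1 − 1/(40 log q)` of `L(s,χ_{d_K})`:
`(0.81/π) √q (1−β) ≤ h_K ≤ (1/π) √q log²q (1−β)` (upper half: `classNumber_le_of_realZero_explicit_v3`).
[cite: BenliGoelTwissZaman2025, Lemma 2.9] [cite: NeukirchANT1999, Ch. VII §5 (5.11)] -/
theorem classNumber_two_sided_of_realZero_explicit (h2 : finrank ℚ K = 2)
    (hodd : Odd (NumberField.discr K)) (hd : NumberField.discr K < 0)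
    (hq : 10 ^ 4 ≤ (NumberField.discr K).natAbs) {β : ℝ}
    (hβ : 1 - 1 / (40 * Real.log (NumberField.discr K).natAbs) ≤ β)
    (hz : (jacobiChar (NumberField.discr K).natAbs).LFunction β = 0) :
    0.81 / Real.pi * Real.sqrt (NumberField.discr K).natAbs * (1 - β) ≤ (classNumber K : ℝ) ∧
      (classNumber K : ℝ) ≤
        1 / Real.pi * Real.sqrt (NumberField.discr K).natAbs *
          Real.log (NumberField.discr K).natAbs ^ 2 * (1 - β) := by
  have hL9 : 9 ≤ Real.log (NumberField.discr K).natAbs := RealZeroRepulsion.nine_le_log' hq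
  have hβ10 : 1 - 1 / (10 * Real.log (NumberField.discr K).natAbs) ≤ β := by
    have : 1 / (40 * Real.log (NumberField.discr K).natAbs) ≤
        1 / (10 * Real.log (NumberField.discr K).natAbs) :=
      one_div_le_one_div_of_le (by positivity) (by linarith)
    linarith
  exact ⟨classNumber_ge_of_realZero_explicit_v3 h2 hodd hd hq hβ10 hz,
    classNumber_le_of_realZero_explicit_v3 h2 hodd hd (le_trans (by norm_num) hq) hβ hz⟩

/-! ### Appended (rc-cond g9): the I.1 reading on the column's predicate — a Siegel zero of quality `η`
pins `h(−q)` between `0.81 √q/(π η log q)` and `55 √q log q/(π η)` (kernel, fact-free) -/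

/-- **Class number of the exceptional field under a Siegel zero of quality `η` (kernel).** For an
imaginary quadratic `K` with odd `d_K`, `q = |d_K| ≥ 10⁴`, whose Kronecker character
`χ_{d_K} = jacobiChar q` carries a Tao–Teräväinen Siegel zero of quality `η` (`η ≥ 10`,
`L(1 − 1/(η log q), χ_{d_K}) = 0`):
`0.81 √q/(π η log q) ≤ h_K ≤ 55 √q log q/(π η)` — lower half `classNumber_ge_of_realZero_explicit`
(window `1/(10 log q)` since `η ≥ 10`), upper half `classNumber_le_of_realZero_explicit` (window
`1/(4 log q)`), both with `w_K = 2`. The «small class number» of the illusory world (I.1) together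
with its floor, in the column's canonical predicate. [cite: TaoTeravainen2021, Definition 1.4]
[cite: BenliGoelTwissZaman2025, Lemma 2.9] [cite: NeukirchANT1999, Ch. VII §5 (5.11)] -/
theorem classNumber_bounds_of_isSiegelZero (h2 : finrank ℚ K = 2)
    (hodd : Odd (NumberField.discr K)) (hd : NumberField.discr K < 0)
    [NeZero (NumberField.discr K).natAbs] (hq : 10 ^ 4 ≤ (NumberField.discr K).natAbs) {η : ℝ}
    (hS : IsSiegelZero (jacobiChar (NumberField.discr K).natAbs) η) :
    0.81 / Real.pi * Real.sqrt (NumberField.discr K).natAbs / (η * Real.log (NumberField.discr K).natAbs)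
        ≤ (classNumber K : ℝ) ∧
      (classNumber K : ℝ) ≤
        55 / Real.pi * Real.sqrt (NumberField.discr K).natAbs *
          Real.log (NumberField.discr K).natAbs / η := by
  set q : ℕ := (NumberField.discr K).natAbs with hqdef
  obtain ⟨hprim, hquad, h10, hzero⟩ := hS
  have hL9 : 9 ≤ Real.log q := RealZeroRepulsion.nine_le_log' hq
  have hL0 : 0 < Real.log q := by linarith
  have hη0 : 0 < η := by linarith
  set β : ℝ := 1 - 1 / (η * Real.log q) with hβdef
  have hκ : 1 - β = 1 / (η * Real.log q) := by rw [hβdef]; ring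
  have hβ10 : 1 - 1 / (10 * Real.log q) ≤ β := by
    have : 1 / (η * Real.log q) ≤ 1 / (10 * Real.log q) :=
      one_div_le_one_div_of_le (by positivity) (mul_le_mul_of_nonneg_right h10 hL0.le)
    rw [hβdef]; linarith
  have hβ4 : 1 - 1 / (4 * Real.log q) ≤ β := by
    have : 1 / (10 * Real.log q) ≤ 1 / (4 * Real.log q) :=
      one_div_le_one_div_of_le (by positivity) (by linarith)
    linarith
  have hd4 : NumberField.discr K < -4 := by
    have : (10 ^ 4 : ℤ) ≤ ((NumberField.discr K).natAbs : ℤ) := by exact_mod_cast hq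
    omega
  have hw : torsionOrder K = 2 := torsionOrder_eq_two_of_discr_lt_neg_four h2 hd4
  have hlow := classNumber_ge_of_realZero_explicit_v3 h2 hodd hd hq hβ10 hzero
  have hup := classNumber_le_of_realZero_explicit h2 hodd hd (le_trans (by norm_num) hq) hβ4 hzero
  rw [hw] at hup
  push_cast at hup
  rw [hκ] at hlow hup
  have hsq0 : 0 ≤ Real.sqrt (q : ℝ) := Real.sqrt_nonneg _
  have hpi : 0 < Real.pi := Real.pi_pos
  constructor
  · calc 0.81 / Real.pi * Real.sqrt q / (η * Real.log q)
        = 0.81 / Real.pi * Real.sqrt q * (1 / (η * Real.log q)) := by ring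
      _ ≤ (classNumber K : ℝ) := hlow
  · calc (classNumber K : ℝ)
        ≤ 55 / (2 * Real.pi) * 2 * Real.sqrt q * Real.log q ^ 2 * (1 / (η * Real.log q)) := hup
      _ = 55 / Real.pi * Real.sqrt q * Real.log q / η := by
          field_simp

end Literature.NumberTheory.LFunctions

end
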